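import Summits.CriticalPhenomena.PercolationContinuityZ3.Theorems.Transplant.FKConnectivityAllQAntipodalAndPlus
import Summits.CriticalPhenomena.PercolationContinuityZ3.Theorems.Transplant.FKConnectivityAllQAntipodalLevel4

/-!
# Connectivity correlation inequalities for `φ_{w,q}`, every `q > 0` — file 64c: **`AND⁺` AT AN ARBITRARY POSITION** (the `AND` rays of the odd cone,
# root-free form)

Support file (`--supports stmt-CriticalPhenomena-4575`), FK sub-lane `prim-bschramm-fk-2` (gen 29); builds on p205010 (kernel theorem,
internal audit signed; external expert review pending).  No definitions, no named facts, no sorries; standard axioms.  Memo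
FROM-fk-2-g29-BRIDGE.md §14 (master-file plan, rays 4–8).

Gen 21's `q`-free AND theorem `FK.apPsiCW_and_nonpos_of_isTTSP` / `FK.apPsiC_levels_le_and_nonpos_of_isTTSP` is stated with the root edge `st`
INSIDE the conjunction.  The level-`k` assembly (files 64a/64b) meets `AND` rays in every placement — in particular `AND(y,z,w)` with the root `x`
free, contracted or deleted.  Duffin re-rooting (`FK.IsTTSP.reroot_erase`: present `H = E ∪ {st}` from any of its edges) moves the root into the
conjunction without touching the antipodal sum, so the theorem holds for EVERY nonempty edge set `T ⊆ H` and every cell `N` (free), `C`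
(contracted) of `H` off `T`: `apPsiCW_andSet_nonpos_of_isTTSP` (antitone weights) and `apPsiC_levels_le_andSet_nonpos_of_isTTSP` (level cut-offs).
[cite: Grimmett2006, §3.8 Thm. (3.90) (pp. 61–62); §3.9 (pp. 63–64)] [cite: Wagner2006, Thm. 5.8(d), §5.3]
-/

noncomputable section

namespace Summit.CriticalPhenomena.PercolationContinuityZ3.Theorems

namespace FK

open SimpleGraph Literature.Probability.LatticeModels Literature.Probability.Percolation
open scoped Classical

variable {V : Type*} [Fintype V]

/-- **`AND⁺` at an arbitrary position, every antitone weight.**  `E` TTSP between `s, t`, `st ∉ E`, `H = E ∪ {st}`; `T ⊆ H` nonempty, `N, C ⊆ H`,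
the three pairwise disjoint (edges of `H` outside `N ∪ T ∪ C` are deleted); `w` antitone; `g` increasing and not reading `T` ⟹
`∑_{γ ⊆ N ∪ T} w(k(γ∪C) + k(((N∪T)\γ)∪C))·(1_{T ⊆ γ∪C} − 1_{T ⊆ ((N∪T)\γ)∪C})·(g(γ∪C) − g(((N∪T)\γ)∪C)) ≤ 0`.
Proof: re-root `H` at an edge of `T` and apply `FK.apPsiCW_and_nonpos_of_isTTSP`.
[cite: Grimmett2006, §3.8 Thm. (3.90) (pp. 61–62); §3.9 (pp. 63–64)] [cite: Wagner2006, Thm. 5.8(d), §5.3] -/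
theorem apPsiCW_andSet_nonpos_of_isTTSP {E : Finset (Sym2 V)} {s t : V} (hE : IsTTSP E s t) (hst : s(s, t) ∉ E)
    {N T C : Finset (Sym2 V)} (hN : N ⊆ insert s(s, t) E) (hT : T ⊆ insert s(s, t) E) (hTne : T.Nonempty)
    (hC : C ⊆ insert s(s, t) E) (hNT : Disjoint N T) (hNC : Disjoint N C) (hTC : Disjoint T C)
    {w : ℕ → ℝ} (hw : ∀ n : ℕ, w (n + 1) ≤ w n)
    {g : Finset (Sym2 V) → ℝ} (hg : ∀ A U : Finset (Sym2 V), U ⊆ T → g (A ∪ U) = g A)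
    (hmono : ∀ ⦃X Y : Finset (Sym2 V)⦄, X ⊆ Y → g X ≤ g Y) :
    ∑ γ ∈ (N ∪ T).powerset, w (apExpC (N ∪ T) C γ) *
        (((if T ⊆ γ ∪ C then (1 : ℝ) else 0) - (if T ⊆ (N ∪ T) \ γ ∪ C then 1 else 0)) *
          (g (γ ∪ C) - g ((N ∪ T) \ γ ∪ C))) ≤ 0 := by
  obtain ⟨e, he⟩ := hTne
  revert he
  refine Sym2.ind (fun e₁ e₂ => ?_) e
  intro he
  -- re-root `H` at `e = e₁e₂ ∈ T`
  have hR : IsTTSP ((insert s(s, t) E).erase s(e₁, e₂)) e₁ e₂ :=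
    hE.reroot_erase (hT he) (insert_ne_singleton_of_isTTSP hE hst _)
  have heE' : s(e₁, e₂) ∉ (insert s(s, t) E).erase s(e₁, e₂) := Finset.notMem_erase _ _
  have heN : s(e₁, e₂) ∉ N := fun h => Finset.disjoint_left.1 hNT h he
  have heC : s(e₁, e₂) ∉ C := fun h => Finset.disjoint_left.1 hTC he h
  have hN' : N ⊆ (insert s(s, t) E).erase s(e₁, e₂) := fun a ha => Finset.mem_erase.2 ⟨fun h => heN (h ▸ ha), hN ha⟩
  have hT' : T.erase s(e₁, e₂) ⊆ (insert s(s, t) E).erase s(e₁, e₂) := Finset.erase_subset_erase _ hT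
  have hC' : C ⊆ (insert s(s, t) E).erase s(e₁, e₂) := fun a ha => Finset.mem_erase.2 ⟨fun h => heC (h ▸ ha), hC ha⟩
  have hNT' : Disjoint N (T.erase s(e₁, e₂)) := hNT.mono_right (Finset.erase_subset _ _)
  have hTC' : Disjoint (T.erase s(e₁, e₂)) C := hTC.mono_left (Finset.erase_subset _ _)
  have hins : insert s(e₁, e₂) (T.erase s(e₁, e₂)) = T := Finset.insert_erase he
  have key := apPsiCW_and_nonpos_of_isTTSP hR heE' hN' hT' hC' hNT' hNC hTC' hw (g := g)
    (fun A U hU => hg A U (by rw [hins] at hU; exact hU)) hmono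
  rw [hins] at key
  exact key

/-- **`AND⁺` at an arbitrary position, partial sums by cluster level.**  Under the hypotheses of `FK.apPsiCW_andSet_nonpos_of_isTTSP` (no weight),
for every level cut-off `J`:
`∑_{γ ⊆ N ∪ T : k(γ∪C)+k(((N∪T)\γ)∪C) ≤ J} (1_{T ⊆ γ∪C} − 1_{T ⊆ ((N∪T)\γ)∪C})·(g(γ∪C) − g(((N∪T)\γ)∪C)) ≤ 0` — the `AND` rays of the odd-cone
assembly (files 64a/64b) in every placement of the root. [cite: Grimmett2006, §3.8 Thm. (3.90) (pp. 61–62); §3.9 (pp. 63–64)]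
[cite: Wagner2006, Thm. 5.8(d), §5.3] -/
theorem apPsiC_levels_le_andSet_nonpos_of_isTTSP {E : Finset (Sym2 V)} {s t : V} (hE : IsTTSP E s t) (hst : s(s, t) ∉ E)
    {N T C : Finset (Sym2 V)} (hN : N ⊆ insert s(s, t) E) (hT : T ⊆ insert s(s, t) E) (hTne : T.Nonempty)
    (hC : C ⊆ insert s(s, t) E) (hNT : Disjoint N T) (hNC : Disjoint N C) (hTC : Disjoint T C) (J : ℕ)
    {g : Finset (Sym2 V) → ℝ} (hg : ∀ A U : Finset (Sym2 V), U ⊆ T → g (A ∪ U) = g A)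
    (hmono : ∀ ⦃X Y : Finset (Sym2 V)⦄, X ⊆ Y → g X ≤ g Y) :
    ∑ γ ∈ (N ∪ T).powerset with apExpC (N ∪ T) C γ ≤ J,
        ((if T ⊆ γ ∪ C then (1 : ℝ) else 0) - (if T ⊆ (N ∪ T) \ γ ∪ C then 1 else 0)) *
          (g (γ ∪ C) - g ((N ∪ T) \ γ ∪ C)) ≤ 0 := by
  have key := apPsiCW_andSet_nonpos_of_isTTSP hE hst hN hT hTne hC hNT hNC hTC (w := fun n => if n ≤ J then (1 : ℝ) else 0)
    (fun n => by
      split_ifs with h1 h2 h2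
      · exact le_rfl
      · exact absurd ((Nat.le_succ n).trans h1) h2
      · exact zero_le_one
      · exact le_rfl) hg hmono
  rw [Finset.sum_filter]
  refine le_of_eq_of_le (Finset.sum_congr rfl fun γ _ => ?_) key
  split_ifs <;> ring

end FK

end Summit.CriticalPhenomena.PercolationContinuityZ3.Theorems
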